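import Literature.NumberTheory.LFunctions.RealZeroRepulsionOddClassSummed
import Literature.NumberTheory.QuadraticFields.ReducedFormsLeadingCoefficients
import HarnessLib

/-!
# A real zero at the scale `1/√d` forces a BOUNDED class number: `L(β, χ_{−d}) = 0` with
# `1 − β ≤ T/√d` ⇒ `h(−d) ≤ 6, 18, 42, 97` for `T = 2, 5, 10, 18` (`d ≥ 10⁶`), uniformly in `d`

Topic `Literature/NumberTheory/LFunctions` (namespace `Literature.NumberTheory.LFunctions`, sub-namespace
`ClassSumRepulsion`). Everything in this file is PROVED (theorems only; no definition, no named fact, debt 0).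
Cell `parity-realchar` (SIEGEL INSTRUMENT): the Direction-I reading («if a Siegel zero exists, then X») of the
class-summed Goldfeld–Schinzel inequality (TARGET §2 row 16 v5) — topic I.1 «class numbers», at the
`1/√d` SCALE and UNIFORMLY IN `d`.

The kernel I.1 line (`RealZeroLOneLowerBoundExplicit.lean`, `SiegelZeroClassNumberAllConductors.lean`) reads a
real zero `β` as `h_K ≤ (1/π)√d·log²d·(1 − β)`: at `1 − β = T/√d` this is `h_K ≤ T log²d/π`, growing with `d`.
The class-summed inequality gives a `d`-free ceiling. At a zero `β ∈ [9/10, 1)` of `L(s, χ)` (`χ` odd real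
primitive mod `d > 4`) the class sum `½Σ_Q Z_Q(β) = ζ(β)L(β, χ)` vanishes, so the sufficient condition of
`LFunction_re_pos_of_odd_quadratic_summed` at `c = (1 − β)√d` must fail:

* `classSum_lt_of_realZero` — **`(1/(1−β) + 0.92)·h(−d) < √d·(π/6 + 2.6(1−β))·Σ_Q 1/a_Q`**;
* with the census `Σ_Q 1/a_Q ≤ h(−d)/30 + 6.2605` (`ReducedFormsLeadingCoefficients.lean`):
  `classNumber_lt_of_realZero` — **`h(−d) < t·u·(h(−d)/30 + 6.2605)`**, `t = (1−β)√d`, `u = π/6 + 2.6(1−β)`,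
  i.e. `h(−d) < 6.2605·tu/(1 − tu/30)` whenever `tu < 30`;
* numeric instances for `d ≥ 10⁶` (`2.6(1 − β) ≤ 2.6T/10³`): a real zero with **`1 − β ≤ 2/√d` forces
  `h(−d) ≤ 6`**; `≤ 5/√d ⇒ h(−d) ≤ 18`; `≤ 10/√d ⇒ h(−d) ≤ 42`; `≤ 18/√d ⇒ h(−d) ≤ 97`
  (`classNumber_le_six/…/_of_realZero_within`); in particular a zero inside Goldfeld–Schinzel's own
  threshold `(6/π)/√d < 2/√d` can only occur with `h(−d) ≤ 6`;
* on the column's predicate: `IsSiegelZero χ η` with `η ≥ √d/(T log d)` means `1 − β₀ ≤ T/√d`, so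
  `classNumber_le_of_isSiegelZero_quality_ge` (**quality `η ≥ √d/(10 log d)` ⇒ `h(−d) ≤ 42`**, `d ≥ 10⁶`).

Field side (`h(−d) = h_K`, tree `Quadratic.card_reducedForms_eq_classNumber`): `…_field` versions. With the
tree's named fact `watkins2004_table4` each ceiling becomes a conductor bound (`h ≤ 97 ⇒ d ≤ 2 383 747`), which
is how `RealZeroRepulsionOddClassNumberHundred.lean` reads it; the ceilings themselves are fact-free.

LABEL (cell rule): conditionals column, topic I.1 at the `1/√d` scale; kernel, hypothesis-free. WHAT THIS IS NOT:
nothing for even characters; no statement at the Siegel scale `1 − β ≍ 1/log d` beyond the I.1 line; nothing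
here bears on parity (H5).

## References (context)

* [GoldfeldSchinzel1975] Theorem 1 and Corollary (case `d < 0`).
* [RalaivaosaonaRazakarinoro2026] Theorem 2 (`1 − β > (2π + o(1))h/((log h)²√d)`: the same monotonicity in
  `h`, asymptotically), Lemma 2.
* [TaoTeravainen2021] Definition 1.4 (`IsSiegelZero`).
* [Cox2013] Thm. 7.7(ii) (`h(d_K) = h_K`).
-/

noncomputable section

open Complex
open Literature.Barriers.Parity
open Literature.NumberTheory.QuadraticFields Literature.NumberTheory.QuadraticFields.Quadratic
open Literature.NumberTheory.QuadraticFields.BinaryQuadraticForm (reducedForms mem_reducedForms_iff)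

namespace Literature.NumberTheory.LFunctions

namespace ClassSumRepulsion

/-- Numerics: `π/6 < 0.5236`. [folklore] -/
private theorem pi_div_six_lt' : Real.pi / 6 < 0.5236 := by
  have := Real.pi_lt_d4
  linarith

/-- The sum `Σ_Q 1/a_Q` over reduced forms of a negative discriminant is non-negative. [folklore] -/
private theorem sum_inv_nonneg' {d : ℕ} (hd : 0 < d) :
    0 ≤ ∑ Q ∈ reducedForms (-(d : ℤ)), (1 : ℝ) / (Q.1 : ℝ) := by
  refine Finset.sum_nonneg fun Q hQ => ?_
  have hD0 : (-(d : ℤ)) < 0 := by omega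
  obtain ⟨-, ha, -, -⟩ := (mem_reducedForms_iff hD0).1 hQ
  have : (0 : ℝ) < Q.1 := by exact_mod_cast ha
  positivity

/-! ### At a real zero the class-sum condition fails -/

/-- **At a real zero `β ∈ [9/10, 1)` of `L(s, χ)`** (`χ` odd real primitive mod `d > 4`):
`(1/(1−β) + 0.92)·h(−d) < (√d·π/6 + 2.6(1−β)√d)·Σ_{Q reduced} 1/a_Q` — otherwise
`LFunction_re_pos_of_odd_quadratic_summed` at `c = (1−β)√d` would give `Re L(β, χ) > 0`.
[cite: GoldfeldSchinzel1975, Theorem 1 (case d < 0)] -/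
theorem classSum_lt_of_realZero {d : ℕ} [NeZero d] (hd : 4 < d)
    {χ : DirichletCharacter ℂ d} (hprim : χ.IsPrimitive) (hquad : χ.IsQuadratic) (hodd : χ.Odd)
    {β : ℝ} (hβ9 : 9 / 10 ≤ β) (hβ1 : β < 1) (hz : χ.LFunction β = 0) :
    (1 / (1 - β) + 0.92) * (BinaryQuadraticForm.classNumber (-(d : ℤ)) : ℝ) <
      (Real.sqrt d * (Real.pi / 6) + 2.6 * ((1 - β) * Real.sqrt d)) *
        ∑ Q ∈ reducedForms (-(d : ℤ)), (1 : ℝ) / (Q.1 : ℝ) := by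
  have hd4R : (4 : ℝ) < d := by exact_mod_cast hd
  have hsd : 2 ≤ Real.sqrt d := (Real.le_sqrt' two_pos).2 (by linarith)
  have hsd0 : 0 < Real.sqrt d := by linarith
  have hδ0 : 0 < 1 - β := by linarith
  set c₀ : ℝ := (1 - β) * Real.sqrt d with hc₀
  have hc0 : 0 < c₀ := by positivity
  have h10 : 10 * c₀ ≤ Real.sqrt d := by rw [hc₀]; nlinarith
  have hcd : c₀ / Real.sqrt d = 1 - β := by rw [hc₀]; field_simp
  have hdc : Real.sqrt d / c₀ = 1 / (1 - β) := by
    rw [hc₀]; field_simp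
  by_contra hcon
  push Not at hcon
  rw [← hdc] at hcon
  exact LFunction_ne_zero_of_odd_quadratic_summed hd hprim hquad hodd hc0 h10 hcon (σ := β)
    (by rw [hcd]; linarith) hβ1 hz

/-- **Class-number ceiling at a real zero near `1`:** with `t = (1−β)√d` and `u = π/6 + 2.6(1−β)`,
`h(−d) < t·u·(h(−d)/30 + 6.2605)` for every real zero `β ∈ [9/10, 1)` of `L(s, χ)` (`χ` odd real
primitive mod `d > 4`) — the census `Σ_Q 1/a_Q ≤ h(−d)/30 + 6.2605` in `classSum_lt_of_realZero`.
[cite: GoldfeldSchinzel1975, Theorem 1 (case d < 0)] [cite: RalaivaosaonaRazakarinoro2026, Lemma 2] -/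
theorem classNumber_lt_of_realZero {d : ℕ} [NeZero d] (hd : 4 < d)
    {χ : DirichletCharacter ℂ d} (hprim : χ.IsPrimitive) (hquad : χ.IsQuadratic) (hodd : χ.Odd)
    {β : ℝ} (hβ9 : 9 / 10 ≤ β) (hβ1 : β < 1) (hz : χ.LFunction β = 0) :
    (BinaryQuadraticForm.classNumber (-(d : ℤ)) : ℝ) <
      ((1 - β) * Real.sqrt d) * (Real.pi / 6 + 2.6 * (1 - β)) *
        ((BinaryQuadraticForm.classNumber (-(d : ℤ)) : ℝ) / 30 + 6.2605) := by
  have hd4R : (4 : ℝ) < d := by exact_mod_cast hd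
  have hsd : 2 ≤ Real.sqrt d := (Real.le_sqrt' two_pos).2 (by linarith)
  have hsd0 : 0 < Real.sqrt d := by linarith
  have hδ0 : 0 < 1 - β := by linarith
  have hD0 : (-(d : ℤ)) < 0 := by omega
  have hmain := classSum_lt_of_realZero hd hprim hquad hodd hβ9 hβ1 hz
  have hcensus := BinaryQuadraticForm.LeadingCoeff.sum_inv_fst_le hD0
  set h : ℝ := (BinaryQuadraticForm.classNumber (-(d : ℤ)) : ℝ) with hh
  set S := ∑ Q ∈ reducedForms (-(d : ℤ)), (1 : ℝ) / (Q.1 : ℝ) with hS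
  have hh0 : 0 ≤ h := by rw [hh]; positivity
  have hupos : 0 < Real.sqrt d * (Real.pi / 6) + 2.6 * ((1 - β) * Real.sqrt d) := by
    have := Real.pi_gt_three; positivity
  -- `(1/(1−β)) h ≤ (1/(1−β) + 0.92) h < (…)·S ≤ (…)(h/30 + 6.2605)`
  have h1 : 1 / (1 - β) * h ≤ (1 / (1 - β) + 0.92) * h := by nlinarith
  have h2 : (Real.sqrt d * (Real.pi / 6) + 2.6 * ((1 - β) * Real.sqrt d)) * S ≤
      (Real.sqrt d * (Real.pi / 6) + 2.6 * ((1 - β) * Real.sqrt d)) * (h / 30 + 6.2605) :=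
    mul_le_mul_of_nonneg_left hcensus hupos.le
  have h3 : 1 / (1 - β) * h < (Real.sqrt d * (Real.pi / 6) + 2.6 * ((1 - β) * Real.sqrt d)) * (h / 30 + 6.2605) :=
    by linarith
  -- multiply by `1 − β > 0`
  have h4 := mul_lt_mul_of_pos_left h3 hδ0
  have e1 : (1 - β) * (1 / (1 - β) * h) = h := by field_simp
  have e2 : (1 - β) * ((Real.sqrt d * (Real.pi / 6) + 2.6 * ((1 - β) * Real.sqrt d)) * (h / 30 + 6.2605)) =
      (1 - β) * Real.sqrt d * (Real.pi / 6 + 2.6 * (1 - β)) * (h / 30 + 6.2605) := by ring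
  rw [e1, e2] at h4
  exact h4

/-- The ceiling with a parameter: if `1 − β ≤ T/√d` (`0 < T`, `10T ≤ √d`) then
`h(−d)·(1 − T·u_T/30) < 6.2605·T·u_T` with `u_T = π/6 + 2.6T/√d`. [cite: GoldfeldSchinzel1975, Theorem 1 (case d < 0)] -/
theorem classNumber_mul_lt_of_realZero_within {d : ℕ} [NeZero d] (hd : 4 < d)
    {χ : DirichletCharacter ℂ d} (hprim : χ.IsPrimitive) (hquad : χ.IsQuadratic) (hodd : χ.Odd)
    {T : ℝ} (hT0 : 0 < T) (hT : 10 * T ≤ Real.sqrt d)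
    {β : ℝ} (hβ1 : β < 1) (hβT : 1 - β ≤ T / Real.sqrt d) (hz : χ.LFunction β = 0) :
    (BinaryQuadraticForm.classNumber (-(d : ℤ)) : ℝ) * (1 - T * (Real.pi / 6 + 2.6 * T / Real.sqrt d) / 30) <
      6.2605 * (T * (Real.pi / 6 + 2.6 * T / Real.sqrt d)) := by
  have hd4R : (4 : ℝ) < d := by exact_mod_cast hd
  have hsd : 2 ≤ Real.sqrt d := (Real.le_sqrt' two_pos).2 (by linarith)
  have hsd0 : 0 < Real.sqrt d := by linarith
  have hTd : T / Real.sqrt d ≤ 1 / 10 := by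
    rw [div_le_div_iff₀ hsd0 (by norm_num)]; linarith
  have hβ9 : 9 / 10 ≤ β := by linarith
  have hmain := classNumber_lt_of_realZero hd hprim hquad hodd hβ9 hβ1 hz
  set h : ℝ := (BinaryQuadraticForm.classNumber (-(d : ℤ)) : ℝ) with hh
  have hh0 : 0 ≤ h := by rw [hh]; positivity
  have hδ0 : 0 < 1 - β := by linarith
  -- `t = (1−β)√d ≤ T` and `u = π/6 + 2.6(1−β) ≤ π/6 + 2.6T/√d`
  have ht : (1 - β) * Real.sqrt d ≤ T := by
    have := mul_le_mul_of_nonneg_right hβT hsd0.le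
    rwa [div_mul_cancel₀ _ hsd0.ne'] at this
  have hu : Real.pi / 6 + 2.6 * (1 - β) ≤ Real.pi / 6 + 2.6 * T / Real.sqrt d := by
    have : 2.6 * (1 - β) ≤ 2.6 * (T / Real.sqrt d) := by linarith
    have e : 2.6 * (T / Real.sqrt d) = 2.6 * T / Real.sqrt d := by ring
    linarith
  have hupos : 0 < Real.pi / 6 + 2.6 * (1 - β) := by have := Real.pi_gt_three; positivity
  have htu : (1 - β) * Real.sqrt d * (Real.pi / 6 + 2.6 * (1 - β)) ≤
      T * (Real.pi / 6 + 2.6 * T / Real.sqrt d) :=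
    mul_le_mul ht hu hupos.le hT0.le
  have hfac : 0 ≤ h / 30 + 6.2605 := by positivity
  have := mul_le_mul_of_nonneg_right htu hfac
  nlinarith

/-! ### Numeric ceilings for `d ≥ 10⁶` -/

/-- `√d ≥ 1000` for `d ≥ 10⁶`. [folklore] -/
private theorem sqrt_ge_thousand {d : ℕ} (hd : 10 ^ 6 ≤ d) : (1000 : ℝ) ≤ Real.sqrt d := by
  have hdR : (10 : ℝ) ^ 6 ≤ d := by exact_mod_cast hd
  exact (Real.le_sqrt' (by norm_num)).2 (by nlinarith)

/-- The generic numeric step: from `h·(1 − T u/30) < 6.2605 T u` with `u ≤ U`, `T U < 30` and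
`6.2605·T·U/(1 − TU/30) < N + 1` conclude `h ≤ N`. Stated with the arithmetic left to the caller:
if `h * (1 - a) < b` with `a ≤ A < 1`, `b ≤ B` and `B ≤ (N + 1) * (1 - A)` then `h ≤ N`. [folklore] -/
private theorem natCeiling {h N : ℕ} {a A b B : ℝ} (hlt : (h : ℝ) * (1 - a) < b) (haA : a ≤ A) (hA1 : A < 1)
    (hbB : b ≤ B) (hB : B ≤ ((N : ℝ) + 1) * (1 - A)) : h ≤ N := by
  by_contra hcon
  push Not at hcon
  have hN : (N : ℝ) + 1 ≤ h := by exact_mod_cast hcon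
  have hh0 : (0 : ℝ) ≤ h := by positivity
  have h1 : (h : ℝ) * (1 - A) ≤ (h : ℝ) * (1 - a) := by nlinarith
  have h2 : ((N : ℝ) + 1) * (1 - A) ≤ (h : ℝ) * (1 - A) := by nlinarith
  linarith

/-- **A real zero with `1 − β ≤ 2/√d` forces `h(−d) ≤ 6`** (`d ≥ 10⁶`; `T u ≤ 2·0.5288`,
`6.2605·1.0576/(1 − 0.03526) < 6.87`). In particular a zero inside Goldfeld–Schinzel's threshold
`(6/π)/√d` needs `h(−d) ≤ 6`. [cite: GoldfeldSchinzel1975, Theorem 1 and Corollary (case d < 0)] -/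
theorem classNumber_le_six_of_realZero_within {d : ℕ} [NeZero d] (hd : 10 ^ 6 ≤ d)
    {χ : DirichletCharacter ℂ d} (hprim : χ.IsPrimitive) (hquad : χ.IsQuadratic) (hodd : χ.Odd)
    {β : ℝ} (hβ1 : β < 1) (hβT : 1 - β ≤ 2 / Real.sqrt d) (hz : χ.LFunction β = 0) :
    BinaryQuadraticForm.classNumber (-(d : ℤ)) ≤ 6 := by
  have hsd := sqrt_ge_thousand hd
  have hπ := pi_div_six_lt'
  have h := classNumber_mul_lt_of_realZero_within (by omega) hprim hquad hodd (T := 2) (by norm_num)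
    (by linarith) hβ1 hβT hz
  have hfrac : 2.6 * 2 / Real.sqrt d ≤ 2.6 * 2 / 1000 := div_le_div_of_nonneg_left (by norm_num) (by norm_num) hsd
  have hu : Real.pi / 6 + 2.6 * 2 / Real.sqrt d ≤ 0.5288 := by linarith
  have hu0 : 0 ≤ Real.pi / 6 + 2.6 * 2 / Real.sqrt d := by have := Real.pi_gt_three; positivity
  exact natCeiling (N := 6) (A := 2 * 0.5288 / 30) (B := 6.2605 * (2 * 0.5288)) h (by nlinarith) (by norm_num)
    (by nlinarith) (by norm_num)

/-- **A real zero with `1 − β ≤ 5/√d` forces `h(−d) ≤ 18`** (`d ≥ 10⁶`).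
[cite: GoldfeldSchinzel1975, Theorem 1 (case d < 0)] -/
theorem classNumber_le_eighteen_of_realZero_within {d : ℕ} [NeZero d] (hd : 10 ^ 6 ≤ d)
    {χ : DirichletCharacter ℂ d} (hprim : χ.IsPrimitive) (hquad : χ.IsQuadratic) (hodd : χ.Odd)
    {β : ℝ} (hβ1 : β < 1) (hβT : 1 - β ≤ 5 / Real.sqrt d) (hz : χ.LFunction β = 0) :
    BinaryQuadraticForm.classNumber (-(d : ℤ)) ≤ 18 := by
  have hsd := sqrt_ge_thousand hd
  have hπ := pi_div_six_lt'
  have h := classNumber_mul_lt_of_realZero_within (by omega) hprim hquad hodd (T := 5) (by norm_num)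
    (by linarith) hβ1 hβT hz
  have hfrac : 2.6 * 5 / Real.sqrt d ≤ 2.6 * 5 / 1000 := div_le_div_of_nonneg_left (by norm_num) (by norm_num) hsd
  have hu : Real.pi / 6 + 2.6 * 5 / Real.sqrt d ≤ 0.5366 := by linarith
  have hu0 : 0 ≤ Real.pi / 6 + 2.6 * 5 / Real.sqrt d := by have := Real.pi_gt_three; positivity
  exact natCeiling (N := 18) (A := 5 * 0.5366 / 30) (B := 6.2605 * (5 * 0.5366)) h (by nlinarith) (by norm_num)
    (by nlinarith) (by norm_num)

/-- **A real zero with `1 − β ≤ 10/√d` forces `h(−d) ≤ 42`** (`d ≥ 10⁶`).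
[cite: GoldfeldSchinzel1975, Theorem 1 (case d < 0)] -/
theorem classNumber_le_fortyTwo_of_realZero_within {d : ℕ} [NeZero d] (hd : 10 ^ 6 ≤ d)
    {χ : DirichletCharacter ℂ d} (hprim : χ.IsPrimitive) (hquad : χ.IsQuadratic) (hodd : χ.Odd)
    {β : ℝ} (hβ1 : β < 1) (hβT : 1 - β ≤ 10 / Real.sqrt d) (hz : χ.LFunction β = 0) :
    BinaryQuadraticForm.classNumber (-(d : ℤ)) ≤ 42 := by
  have hsd := sqrt_ge_thousand hd
  have hπ := pi_div_six_lt'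
  have h := classNumber_mul_lt_of_realZero_within (by omega) hprim hquad hodd (T := 10) (by norm_num)
    (by linarith) hβ1 hβT hz
  have hfrac : 2.6 * 10 / Real.sqrt d ≤ 2.6 * 10 / 1000 := div_le_div_of_nonneg_left (by norm_num) (by norm_num) hsd
  have hu : Real.pi / 6 + 2.6 * 10 / Real.sqrt d ≤ 0.5496 := by linarith
  have hu0 : 0 ≤ Real.pi / 6 + 2.6 * 10 / Real.sqrt d := by have := Real.pi_gt_three; positivity
  exact natCeiling (N := 42) (A := 10 * 0.5496 / 30) (B := 6.2605 * (10 * 0.5496)) h (by nlinarith) (by norm_num)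
    (by nlinarith) (by norm_num)

/-- **A real zero with `1 − β ≤ 18/√d` forces `h(−d) ≤ 97`** (`d ≥ 10⁶`) — the contrapositive face of
`one_sub_realZero_gt_eighteen_of_classNumber_ge`. [cite: GoldfeldSchinzel1975, Theorem 1 (case d < 0)]
[cite: RalaivaosaonaRazakarinoro2026, Lemma 2] -/
theorem classNumber_le_ninetySeven_of_realZero_within {d : ℕ} [NeZero d] (hd : 10 ^ 6 ≤ d)
    {χ : DirichletCharacter ℂ d} (hprim : χ.IsPrimitive) (hquad : χ.IsQuadratic) (hodd : χ.Odd)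
    {β : ℝ} (hβ1 : β < 1) (hβT : 1 - β ≤ 18 / Real.sqrt d) (hz : χ.LFunction β = 0) :
    BinaryQuadraticForm.classNumber (-(d : ℤ)) ≤ 97 := by
  have hsd := sqrt_ge_thousand hd
  have hπ := pi_div_six_lt'
  have h := classNumber_mul_lt_of_realZero_within (by omega) hprim hquad hodd (T := 18) (by norm_num)
    (by linarith) hβ1 hβT hz
  have hfrac : 2.6 * 18 / Real.sqrt d ≤ 2.6 * 18 / 1000 := div_le_div_of_nonneg_left (by norm_num) (by norm_num) hsd
  have hu : Real.pi / 6 + 2.6 * 18 / Real.sqrt d ≤ 0.5704 := by linarith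
  have hu0 : 0 ≤ Real.pi / 6 + 2.6 * 18 / Real.sqrt d := by have := Real.pi_gt_three; positivity
  exact natCeiling (N := 97) (A := 18 * 0.5704 / 30) (B := 6.2605 * (18 * 0.5704)) h (by nlinarith) (by norm_num)
    (by nlinarith) (by norm_num)

/-! ### On the column's predicate and on the field side -/

/-- **A Siegel zero of quality `η ≥ √d/(10 log d)` forces `h(−d) ≤ 42`** (`χ` odd, `d ≥ 10⁶`): its zero
`β₀ = 1 − 1/(η log d)` has `1 − β₀ ≤ 10/√d`. [cite: TaoTeravainen2021, Definition 1.4]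
[cite: GoldfeldSchinzel1975, Theorem 1 (case d < 0)] -/
theorem classNumber_le_of_isSiegelZero_quality_ge {d : ℕ} [NeZero d] (hd : 10 ^ 6 ≤ d)
    {χ : DirichletCharacter ℂ d} {η : ℝ} (hS : IsSiegelZero χ η) (hodd : χ.Odd)
    (hη : Real.sqrt d / (10 * Real.log d) ≤ η) :
    BinaryQuadraticForm.classNumber (-(d : ℤ)) ≤ 42 := by
  obtain ⟨hprim, hquad, h10, hzero⟩ := hS
  have hdR : (10 : ℝ) ^ 6 ≤ d := by exact_mod_cast hd
  have hlog : 0 < Real.log d := Real.log_pos (by linarith)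
  have hη0 : 0 < η := by linarith
  have hsd0 : 0 < Real.sqrt d := Real.sqrt_pos.2 (by linarith)
  have hβ1 : 1 - 1 / (η * Real.log d) < 1 := by
    have : 0 < 1 / (η * Real.log d) := by positivity
    linarith
  refine classNumber_le_fortyTwo_of_realZero_within hd hprim hquad hodd hβ1 ?_ (by exact_mod_cast hzero)
  rw [show (1 : ℝ) - (1 - 1 / (η * Real.log d)) = 1 / (η * Real.log d) by ring]
  -- `1/(η log d) ≤ 10/√d` ⇔ `√d ≤ 10 η log d`
  rw [div_le_div_iff₀ (by positivity) hsd0]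
  rw [div_le_iff₀ (by positivity)] at hη
  linarith

variable {K : Type*} [Field K] [NumberField K]

/-- **Field side: a real zero with `1 − β ≤ 10/√d` forces `h_K ≤ 42`** for the imaginary quadratic field `K`
with `d_K = −d` (`d ≥ 10⁶`, `χ` the Kronecker character of `K`). [cite: Cox2013, §7.B Thm. 7.7(ii)]
[cite: GoldfeldSchinzel1975, Theorem 1 (case d < 0)] -/
theorem classNumber_le_fortyTwo_of_realZero_within_field (h2 : Module.finrank ℚ K = 2) {d : ℕ} [NeZero d]
    (hdK : NumberField.discr K = -(d : ℤ)) (hd : 10 ^ 6 ≤ d) {χ : DirichletCharacter ℂ d}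
    (hprim : χ.IsPrimitive) (hquad : χ.IsQuadratic) (hodd : χ.Odd)
    {β : ℝ} (hβ1 : β < 1) (hβT : 1 - β ≤ 10 / Real.sqrt d) (hz : χ.LFunction β = 0) :
    NumberField.classNumber K ≤ 42 := by
  have hdneg : NumberField.discr K < 0 := by rw [hdK]; omega
  have hh := card_reducedForms_eq_classNumber h2 hdneg
  rw [hdK] at hh
  rw [← hh]
  exact classNumber_le_fortyTwo_of_realZero_within hd hprim hquad hodd hβ1 hβT hz

/-- **Field side: a real zero with `1 − β ≤ 2/√d` forces `h_K ≤ 6`** (`d_K = −d`, `d ≥ 10⁶`).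
[cite: Cox2013, §7.B Thm. 7.7(ii)] [cite: GoldfeldSchinzel1975, Theorem 1 (case d < 0)] -/
theorem classNumber_le_six_of_realZero_within_field (h2 : Module.finrank ℚ K = 2) {d : ℕ} [NeZero d]
    (hdK : NumberField.discr K = -(d : ℤ)) (hd : 10 ^ 6 ≤ d) {χ : DirichletCharacter ℂ d}
    (hprim : χ.IsPrimitive) (hquad : χ.IsQuadratic) (hodd : χ.Odd)
    {β : ℝ} (hβ1 : β < 1) (hβT : 1 - β ≤ 2 / Real.sqrt d) (hz : χ.LFunction β = 0) :
    NumberField.classNumber K ≤ 6 := by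
  have hdneg : NumberField.discr K < 0 := by rw [hdK]; omega
  have hh := card_reducedForms_eq_classNumber h2 hdneg
  rw [hdK] at hh
  rw [← hh]
  exact classNumber_le_six_of_realZero_within hd hprim hquad hodd hβ1 hβT hz

end ClassSumRepulsion

end Literature.NumberTheory.LFunctions
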